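import Mathlib
import Summits.Parity.BatemanHorn.Theses.IsogenyRedei

/-!
# Sketch — crux-ideate stmt-Parity-11583 (SplitBlockJacobi), ideator 2, round 1

First lemmas of the two idea cards, stated over existing declarations (Mathlib + the route file).
Nothing here is proved; every `def` is a `Prop`.
-/

namespace Summit.Parity.BatemanHorn.Cruxes.SplitBlockJacobi.Ideate2

open Filter Finset

/-- Card `quartic-gauss-half-spin`, FIRST LEMMA (rational form of `(Q|Q′) = [ρ/π]₂`, verified for all
1160 cases t ≤ 6000): if `t` is even and `t²+1 = Q·Q′` with distinct primes, and `ρ = c + d i` is the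
PRIMARY Gaussian prime of norm `Q′` dividing `t + i` (c odd, d even, c + d ≡ 1 mod 4, Q′ ∣ c t + d), then
`(Q|Q′) = ((c − d t) | Q)` — the conjugate half-spin `[ρ̄/π]₂` is identically `+1`. -/
def HalfSpinAtom : Prop :=
  ∀ t Q Q' : ℕ, Even t → Q.Prime → Q'.Prime → Q ≠ Q' → t ^ 2 + 1 = Q * Q' →
    ∀ c d : ℤ, c ^ 2 + d ^ 2 = (Q' : ℤ) → Odd c → Even d → c + d ≡ 1 [ZMOD 4] →
      (Q' : ℤ) ∣ c * t + d → jacobiSym (Q : ℤ) Q' = jacobiSym (c - d * t) Q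

/-- Card `quartic-gauss-half-spin`, the SL₂(ℤ)-orbit parametrisation behind the metaplectic line:
factorisations `t²+1 = D·D′` are exactly matrices `γ = ((p,q),(r,s)) ∈ SL₂(ℤ)` with
`D = p²+q²`, `D′ = r²+s²`, `t = pr+qs` (so `γ·i = (t+i)/D′`, `γγᵀ = ((D,t),(t,D′))`). -/
def OrbitParametrisation : Prop :=
  ∀ t D D' : ℕ, D * D' = t ^ 2 + 1 →
    ∃ p q r s : ℤ, p * s - q * r = 1 ∧ p ^ 2 + q ^ 2 = (D : ℤ) ∧ r ^ 2 + s ^ 2 = (D' : ℤ) ∧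
      p * r + q * s = (t : ℤ)

/-- Second two-squares representation: with `γ` as above, `k = ps+qr`, `t′ = pr−qs` satisfy
`t²+1 = t′²+k²`, `k` odd, and `(D|D′) = (k|D′)` for odd coprime `D, D′` (checked t = 8, 12, 30). -/
def SecondRepresentation : Prop :=
  ∀ p q r s : ℤ, p * s - q * r = 1 → Odd (r ^ 2 + s ^ 2) → Odd (p ^ 2 + q ^ 2) →
    (p * r + q * s) ^ 2 + 1 = (p * r - q * s) ^ 2 + (p * s + q * r) ^ 2 ∧
      jacobiSym (p ^ 2 + q ^ 2) (r ^ 2 + s ^ 2).toNat = jacobiSym (p * s + q * r) (r ^ 2 + s ^ 2).toNat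

/-- The trivial mass of the crux at threshold `θ`: number of triples `(t, Q, Q′)`, `t ≤ x`,
`Q < Q′` prime factors of `t²+1` with `Q > x^θ` (the support of `SplitBlockJacobi`'s summand). -/
noncomputable def splitMass (θ : ℝ) (x : ℕ) : ℕ :=
  ∑ t ∈ Icc 1 x, (((t ^ 2 + 1).primeFactors ×ˢ (t ^ 2 + 1).primeFactors).filter
    (fun q : ℕ × ℕ => (x : ℝ) ^ θ < (q.1 : ℝ) ∧ q.1 < q.2)).card

/-- Card `split-mass-middle-prime`, FIRST LEMMA (unconditional, upper-bound sieve): the mass of TWO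
co-large prime factors vanishes linearly as `θ → 1`: `splitMass θ x ≤ C (1 − θ) x` eventually, with an
absolute `C` (proof sketch: `m = (t²+1)/(QQ′) ≤ 2x^{2−2θ}`, Selberg's upper bound for `(t²+1)/m` free
of prime factors `≤ x^θ` along the root classes mod `m`, and `Σ_{m ≤ 2x^{2−2θ}} ρ(m)/m ≪ (1−θ) log x`).
Measured: mass/x = 0.215, 0.106, 0.041, 0.0086, 0.0018 at θ = .6, .7, .8, .9, .95 (item evidence). -/
def SplitMassVanishes : Prop :=
  ∃ C : ℝ, 0 < C ∧ ∀ θ : ℝ, 3 / 4 ≤ θ → θ < 1 →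
    ∀ᶠ x : ℕ in atTop, (splitMass θ x : ℝ) ≤ C * (1 - θ) * x

/-- Card `split-mass-middle-prime`, the TRANSFER target C⁺ = MiddlePrimeJacobi: the same Jacobi sum
restricted to pairs whose SMALLER prime is enumerable, `x^θ < Q ≤ x^{θ′}` with `θ′ < 1` (so `t` runs
over root progressions mod `Q` of length `≥ x^{1−θ′} → ∞`). -/
def MiddlePrimeJacobi : Prop :=
  ∀ θ θ' : ℝ, 1 / 2 < θ → θ < θ' → θ' < 1 →
    (fun x : ℕ => ∑ t ∈ Icc 1 x, ∑ q ∈ ((t ^ 2 + 1).primeFactors ×ˢ (t ^ 2 + 1).primeFactors).filter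
        (fun q : ℕ × ℕ => (x : ℝ) ^ θ < (q.1 : ℝ) ∧ (q.1 : ℝ) ≤ (x : ℝ) ^ θ' ∧ q.1 < q.2),
        (jacobiSym (q.1 : ℤ) q.2 : ℝ)) =o[atTop] fun x : ℕ => (x : ℝ)

/-- The transfer claim (pure bookkeeping given the mass lemma): `J_θ = (J_θ − J_{θ′}) + J_{θ′}` and
`|J_{θ′}| ≤ splitMass θ′ x ≤ C(1−θ′)x`; conversely `J_θ − J_{θ′}` is a difference of two `o(x)`. -/
def TransferClaim : Prop :=
  SplitMassVanishes →
    (MiddlePrimeJacobi ↔ Summit.Parity.BatemanHorn.Theses.IsogenyRedei.SplitBlockJacobi)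

end Summit.Parity.BatemanHorn.Cruxes.SplitBlockJacobi.Ideate2
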